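import Summits.MatrixMultiplication.MatrixMultiplication.Theorems.AbelianSTPPCensusVQKWitness477

/-!
# The successor instrument vQK := vP ∧ E3⁺ ∧ E3K is also blind at order 478 for T_E: `(6,6,8)⁴ + (4,5,3)`

Cell mm-stpp, rung F-M1; successor kernel item «vQK T_E ladder beyond 471» in support of the closed crux item
stmt-MatrixMultiplication-19191; seat mm-stpp-vp-p2 (gen 3).  Companion of eng-2 g7's `…VQKWitness477` (order 477, `(8,6,6)⁴ + (5,4,3)`)
and its order-480 witness `(8,6,6)⁴ + (4,4,4)`: the list at which this seat's vQK certificate search `ShapeCertVQ.checkQK` fails at order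
`478` (first unkilled beating prefix of the search, seat extraction `work/scratch/WitnessK.lean`) — the same thin family,
`(6,6,8)⁴ + (4,5,3)` = size vectors `![6,6,6,6,4]`, `![6,6,6,6,5]`, `![8,8,8,8,3]` — is vP-admissible (`478 = 2·239` composite, so U11-P is
not invoked), E3⁺-admissible and E3K-admissible, and beats `5/2` (`4·112.07 + 30.3 = 478.58 > 478`); its least E3K margin is `151` (`w478_e3k_slack`).  So the orders `477`, `478`, `480`
are vQK-alive for T_E by explicit kernel witnesses (`479` is prime: there the search's surviving list `(6,6,8)⁴ + (4,4,4)` would have to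
pass U11-P, which the checker does not test — eng-2's PROBE j286153 reports 479 EXCLUDED under vP ∧ E3K).
WHAT THIS IS NOT: no existence claim (no STPP family with these shapes is known in any abelian group of order 478); an instrument
fact (what a successor rule must kill), not a census number; no `ω` statement.
-/

set_option linter.dupNamespace false -- `MatrixMultiplication.MatrixMultiplication` (summit = problem, D-0017)
set_option autoImplicit false

namespace Summit.MatrixMultiplication.MatrixMultiplication.Theorems

namespace AbelianSTPPCensusVP

open Finset STPPThreeRoomEnergy

/-! ## Order 478: `(6,6,8)⁴ + (4,5,3)` = size vectors `![6,6,6,6,4]`, `![6,6,6,6,5]`, `![8,8,8,8,3]` -/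

/-- The 478 witness beats `5/2` (certified sixth-power bounds `112.07 ≤ 288^{5/6}`, `30.3 ≤ 60^{5/6}`; `4·112.07 + 30.3 = 478.58 > 478`).
[original] -/
theorem w478_beats : Beats (5 / 2) 478 (![6, 6, 6, 6, 4] : Fin 5 → ℕ) ![6, 6, 6, 6, 5] ![8, 8, 8, 8, 3] := by
  unfold Beats
  have h1 : (112.07 : ℝ) ≤ (288 : ℝ) ^ ((5 : ℝ) / 6) := le_rpow_five_sixths (by norm_num) (by norm_num) (by norm_num)
  have h2 : (30.3 : ℝ) ≤ (60 : ℝ) ^ ((5 : ℝ) / 6) := le_rpow_five_sixths (by norm_num) (by norm_num) (by norm_num)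
  have hexp : ((5 : ℝ) / 2 / 3) = (5 : ℝ) / 6 := by norm_num
  simp only [Fin.sum_univ_five, shapeVol, hexp]
  simp only [Matrix.cons_val_zero, Matrix.cons_val_one, Matrix.cons_val]
  norm_num
  linarith

set_option maxRecDepth 20000 in
/-- The 478 witness is vP-admissible at the composite order `478 = 2·239` (vM by evaluation; U11-G in all three letter forms; U11-P not
invoked). [original] -/
theorem w478_admissible : SieveAdmissibleVP 478 (![6, 6, 6, 6, 4] : Fin 5 → ℕ) ![6, 6, 6, 6, 5] ![8, 8, 8, 8, 3] := by
  refine ⟨?_, ?_, fun hp => absurd hp (by norm_num)⟩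
  · refine ⟨by decide, by decide, by decide, by decide, by decide, ?_, ?_⟩
    · intro l
      refine ⟨by revert l; decide, fun h => absurd h (by revert l; decide), by revert l; decide,
        fun h => absurd h (by revert l; decide), by revert l; decide, fun h => absurd h (by revert l; decide)⟩
    · intro l
      refine ⟨fun h _ => absurd h (by revert l; decide), fun h _ => absurd h (by revert l; decide),
        fun h _ => absurd h (by revert l; decide)⟩
  · refine ⟨?_, ?_, ?_⟩ <;> (unfold U11GFormB; decide)

/-- The 478 witness is E3⁺-admissible. [original] -/
theorem w478_e3pAdm : E3pAdm 478 (![6, 6, 6, 6, 4] : Fin 5 → ℕ) ![6, 6, 6, 6, 5] ![8, 8, 8, 8, 3] := by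
  intro t _
  revert t
  decide

/-- The 478 witness is E3K-admissible (all three pair classes). [original] -/
theorem w478_e3kAdm : E3kAdm 478 (![6, 6, 6, 6, 4] : Fin 5 → ℕ) ![6, 6, 6, 6, 5] ![8, 8, 8, 8, 3] := by
  unfold E3kAdm E3kAdmAB
  decide +kernel

/-- E3K margins of a heavy member `(6,6,8)` of the 478 witness in its three pair classes (data `(a,b,c)`, `(b,c,a)`, `(c,a,b)` with the
off-member sums `Σbc = 159`, `Σca = 156`, `Σab = 128` rotated alike): `288² − e3kLHS = 151, 1112, 899` — the rule misses by `151`.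
[bookkeeping] -/
theorem w478_e3k_slack : 288 ^ 2 - e3kLHS 478 6 6 8 159 156 128 = 151 ∧ 288 ^ 2 - e3kLHS 478 6 8 6 156 128 159 = 1112 ∧
    288 ^ 2 - e3kLHS 478 8 6 6 128 159 156 = 899 := by
  refine ⟨?_, ?_, ?_⟩ <;> decide +kernel

/-- **The instrument vP ∧ E3⁺ ∧ E3K is blind at order 478 for T_E.** [original] -/
theorem vqkCensusTE_fails_at_478 :
    ∃ (N : ℕ) (a b c : Fin N → ℕ), 2 ≤ N ∧ SieveAdmissibleVP 478 a b c ∧ E3pAdm 478 a b c ∧ E3kAdm 478 a b c ∧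
      Beats (5 / 2) 478 a b c :=
  ⟨5, _, _, _, by norm_num, w478_admissible, w478_e3pAdm, w478_e3kAdm, w478_beats⟩

end AbelianSTPPCensusVP

end Summit.MatrixMultiplication.MatrixMultiplication.Theorems
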